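import Literature.AlgebraicGeometry.Resolution.PolygonInvariantsIndexed
import Literature.AlgebraicGeometry.Resolution.WeightedOrderCoordinateChangesIndexed
import HarnessLib

/-!
# (R3a) Hironaka's polygon is blind to UNIT RESCALINGS of the frame: `(εᵢ cᵢ)ᵢ` has the same Newton points, `δ`, `α`, `β`
# as `(cᵢ)ᵢ` (cell `res-dim4-pi`, K2(p) lane, slice C `(5,3)` — the Φ-line's (R3) «LOSE law, translated variant», part a)

[OURS · counted 0 · cell `res-dim4-pi` · K2(p) lane holder res-dim4-p-12 g4's (5,3) residue list (res-dim4-idea-1 g7 R1–R5), item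
(R3) «p-2 takes the LOSE law in a chart `j ≠ h`» (HOLDER WORD g4-2, 2026-08-29 05:53Z); seat res-dim4-p-2 g5; pattern = res-dim4-p-11 g4's
(K-Φ2) V `…PhiLinePolygonTransport` (ring isomorphisms).]  Nothing here proves K2(5), the β_h line or resolution of singularities in
dimension ≥ 4 / characteristic `p` — NOT proved.  AI kernel work, weaker than expert review.

WHY.  At a LOSE-h step presented in a chart `j ≠ h` (`b_j = 0`, `b_h ≠ 0`) the local chart homomorphism sends the critical letter to
`φ(x_h) = x_j · (x_h + b_h)` = newborn × UNIT, whereas the abstract point-blow-up laws (`Literature…PointBlowupPolygonLawsIndexed`, pivot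
`u1`) want the arrival pivot to be `φ` of the departure pivot ON THE NOSE.  Part b applies those laws to the unit-rescaled arrival frame
`c″ = E • c′` and returns to the linear arrival frame `c′` by the lemmas of this file:

* `cmonom_rescale` — `(E • c)^m = E^m · c^m`; `weightedOrderIdeal_rescale` — `F_ρ(E • c) = F_ρ(c)` (SAME ideal, no transport);
* **`isInitialTerm_rescale_iff`**, `occ_rescale`, **`pts_rescale`**, `deltaS_rescale`, `alphaS_rescale`, `betaS_rescale` — the Newton point
  set and the scaled invariants of `(c, J, μ)` do not change when every `cᵢ` is multiplied by a unit `Eᵢ` (the representing weighted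
  form `F` is replaced by `Σ_m (E^m)⁻¹·F_m·X^m`, which has the same support and unit coefficients);
* `span_range_rescale` (the rescaled frame generates the same ideal), `colon_singleton_unit_mul` (`(I : u·a) = (I : a)` for a unit `u`).

[cite: CossartJannsenSaito2020, Def. 7.2 (1), Def. 8.2, Def. 11.1] bears_on: LADDER-RESOLUTION:D157-DOOR2 (res-dim4-pi · K2(p) · slice C
(5,3) · Φ-line (R3a)).  Supports stmt-ResolutionOfSingularities-16155 (helper).
-/

noncomputable section

open IsLocalRing MvPolynomial
open Literature.AlgebraicGeometry.Resolution (cmonom weightedOrderIdeal eval_monomial_eq_cmonom apply_mem_weightedOrderIdeal)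
open Literature.AlgebraicGeometry.Resolution.WeightedOrder

set_option linter.dupNamespace false

namespace Summit.ResolutionOfSingularities.ResolutionOfSingularities.Theorems.PIDim4.PhiLine

universe u v

section Rescale

variable {R : Type u} [CommRing R] {σ : Type v} (c : σ → R) (E : σ → Rˣ)

/-- **Monomials of the rescaled frame**: `(E • c)^m = E^m · c^m`. [cite: CossartJannsenSaito2020, (7.3)] -/
theorem cmonom_rescale (m : σ →₀ ℕ) :
    cmonom (fun i => (E i : R) * c i) m = ((m.prod fun i k => E i ^ k : Rˣ) : R) * cmonom c m := by
  classical
  unfold cmonom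
  rw [Finsupp.prod, Finsupp.prod, Finsupp.prod, Units.coe_prod, ← Finset.prod_mul_distrib]
  refine Finset.prod_congr rfl fun i _ => ?_
  rw [mul_pow, Units.val_pow_eq_pow_val]

/-- The inverse rescaling restores the frame: `E⁻¹ • (E • c) = c`. [folklore] -/
theorem rescale_inv_rescale : (fun i => ((E i)⁻¹ : Rˣ) * ((E i : R) * c i)) = c := by
  funext i
  rw [← mul_assoc, Units.inv_mul, one_mul]

/-- **Weighted order ideals are blind to unit rescalings**: `F_ρ(E • c) = F_ρ(c)`. [cite: CossartJannsenSaito2020, Def. 7.2 (1)] -/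
theorem weightedOrderIdeal_rescale (w : σ → ℕ) (ρ : ℕ) :
    weightedOrderIdeal (fun i => (E i : R) * c i) w ρ = weightedOrderIdeal c w ρ := by
  refine weightedOrderIdeal_eq_of_forall_apply_mem c _ w (fun i => ?_) (fun i => ?_) ρ
  · exact Ideal.mul_mem_left _ _ (apply_mem_weightedOrderIdeal c w i)
  · have h := Ideal.mul_mem_left _ ((E i)⁻¹ : Rˣ).val (apply_mem_weightedOrderIdeal (fun i => (E i : R) * c i) w i)
    rwa [← mul_assoc, Units.inv_mul, one_mul] at h

/-- Evaluation of a polynomial at a frame, monomialwise. [folklore] -/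
theorem eval_eq_sum_cmonom (F : MvPolynomial σ R) : eval c F = ∑ d ∈ F.support, F.coeff d * cmonom c d := by
  conv_lhs => rw [F.as_sum]
  rw [map_sum]
  exact Finset.sum_congr rfl fun d _ => eval_monomial_eq_cmonom c d _

/-- **Initial unit terms survive a unit rescaling** (one direction). [cite: CossartJannsenSaito2020, Def. 8.2] -/
theorem isInitialTerm_rescale_of (w : σ → ℕ) {f : R} {m : σ →₀ ℕ} (h : IsInitialTerm c w f m) :
    IsInitialTerm (fun i => (E i : R) * c i) w f m := by
  classical
  obtain ⟨F, hF, hFu, hrem⟩ := h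
  -- the transported form: divide the coefficient at `d` by the unit `E^d`
  set U : (σ →₀ ℕ) → Rˣ := fun d => d.prod fun i k => E i ^ k with hU
  set F' : MvPolynomial σ R := ∑ d ∈ F.support, monomial d (F.coeff d * ((U d)⁻¹ : Rˣ)) with hF'
  have hcoeff : ∀ d, F'.coeff d = F.coeff d * ((U d)⁻¹ : Rˣ) := by
    intro d
    rw [hF', coeff_sum]
    by_cases hd : d ∈ F.support
    · rw [Finset.sum_eq_single d (fun d' _ hd' => by rw [coeff_monomial, if_neg hd']) (fun h => absurd hd h),
        coeff_monomial, if_pos rfl]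
    · rw [Finset.sum_eq_zero (fun d' hd' => by
        rw [coeff_monomial, if_neg (fun h : d' = d => hd (h ▸ hd'))]), notMem_support_iff.mp hd, zero_mul]
  refine ⟨F', fun d hd => ?_, ?_, ?_⟩
  · -- same weights: the support only shrinks
    rw [hcoeff] at hd
    exact hF (fun h0 => hd (by rw [h0, zero_mul]))
  · rw [hcoeff]
    exact hFu.mul (Units.isUnit _)
  · -- same value, same remainder ideal
    have hev : eval (fun i => (E i : R) * c i) F' = eval c F := by
      rw [eval_eq_sum_cmonom, eval_eq_sum_cmonom]
      have hsupp : F'.support ⊆ F.support := fun d hd => by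
        rw [mem_support_iff, hcoeff] at hd
        exact mem_support_iff.mpr fun h0 => hd (by rw [h0, zero_mul])
      rw [Finset.sum_subset hsupp (fun d _ hd => by rw [notMem_support_iff.mp hd, zero_mul])]
      refine Finset.sum_congr rfl fun d _ => ?_
      rw [hcoeff, cmonom_rescale, hU]
      rw [mul_assoc, ← mul_assoc (((d.prod fun i k => E i ^ k)⁻¹ : Rˣ) : R), Units.inv_mul, one_mul]
    rw [hev, weightedOrderIdeal_rescale]
    exact hrem

/-- **Initial unit terms are blind to unit rescalings of the frame.** [cite: CossartJannsenSaito2020, Def. 8.2] -/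
theorem isInitialTerm_rescale_iff (w : σ → ℕ) (f : R) (m : σ →₀ ℕ) :
    IsInitialTerm (fun i => (E i : R) * c i) w f m ↔ IsInitialTerm c w f m := by
  refine ⟨fun h => ?_, isInitialTerm_rescale_of c E w⟩
  have h' := isInitialTerm_rescale_of (fun i => (E i : R) * c i) (fun i => (E i)⁻¹) w h
  rwa [rescale_inv_rescale] at h'

/-- **Newton point sets are blind to unit rescalings**: `occ (E • c) J = occ c J`. [cite: CossartJannsenSaito2020, Def. 8.5 (4)] -/
theorem occ_rescale (J : Ideal R) : occ (fun i => (E i : R) * c i) J = occ c J := by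
  ext m
  constructor
  · rintro ⟨f, hf, w, hw, hinit⟩
    exact ⟨f, hf, w, hw, (isInitialTerm_rescale_iff c E w f m).mp hinit⟩
  · rintro ⟨f, hf, w, hw, hinit⟩
    exact ⟨f, hf, w, hw, (isInitialTerm_rescale_iff c E w f m).mpr hinit⟩

/-- **The rescaled frame generates the same ideal.** [folklore] -/
theorem span_range_rescale : Ideal.span (Set.range fun i => (E i : R) * c i) = Ideal.span (Set.range c) := by
  refine le_antisymm (Ideal.span_le.mpr ?_) (Ideal.span_le.mpr ?_)
  · rintro _ ⟨i, rfl⟩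
    exact Ideal.mul_mem_left _ _ (Ideal.subset_span ⟨i, rfl⟩)
  · rintro _ ⟨i, rfl⟩
    have h : ((E i)⁻¹ : Rˣ) * ((E i : R) * c i) ∈ Ideal.span (Set.range fun i => (E i : R) * c i) :=
      Ideal.mul_mem_left _ _ (Ideal.subset_span ⟨i, rfl⟩)
    rwa [← mul_assoc, Units.inv_mul, one_mul] at h

/-- **Colon ideals do not see units**: `(I : u·a) = (I : a)` for a unit `u`. [folklore] -/
theorem colon_singleton_unit_mul {I : Ideal R} {u a : R} (hu : IsUnit u) : I.colon {u * a} = I.colon {a} := by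
  obtain ⟨u, rfl⟩ := hu
  ext x
  simp only [Submodule.mem_colon, Set.mem_singleton_iff, forall_eq, smul_eq_mul]
  constructor
  · intro h
    have h' := I.mul_mem_left ((u⁻¹ : Rˣ) : R) h
    rwa [show ((u⁻¹ : Rˣ) : R) * (x * ((u : R) * a)) = x * a by
      rw [mul_left_comm, ← mul_assoc ((u⁻¹ : Rˣ) : R), Units.inv_mul, one_mul]] at h'
  · intro h
    rw [mul_left_comm]
    exact I.mul_mem_left _ h

end Rescale

section Polygon

variable {R : Type u} [CommRing R] {r : ℕ} (c : Fin (r + 2) → R) (E : Fin (r + 2) → Rˣ) (J : Ideal R) (μ : ℕ)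

/-- **The polygon's point set is blind to unit rescalings of the frame**: `pts (E • c) J μ = pts c J μ`.
[cite: CossartJannsenSaito2020, Def. 8.5 (4)] -/
theorem pts_rescale : pts (fun i => (E i : R) * c i) J μ = pts c J μ := by
  ext m
  simp only [pts, Set.mem_setOf_eq, occ_rescale]

/-- `δ` is blind to unit rescalings. [cite: CossartJannsenSaito2020, Def. 11.1] -/
theorem deltaS_rescale : deltaS (fun i => (E i : R) * c i) J μ = deltaS c J μ := by
  unfold deltaS; rw [pts_rescale]

/-- `α` is blind to unit rescalings. [cite: CossartJannsenSaito2020, Def. 11.1] -/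
theorem alphaS_rescale : alphaS (fun i => (E i : R) * c i) J μ = alphaS c J μ := by
  unfold alphaS; rw [pts_rescale]

/-- `β` is blind to unit rescalings. [cite: CossartJannsenSaito2020, Def. 11.1] -/
theorem betaS_rescale : betaS (fun i => (E i : R) * c i) J μ = betaS c J μ := by
  unfold betaS; rw [pts_rescale, alphaS_rescale]

end Polygon

end Summit.ResolutionOfSingularities.ResolutionOfSingularities.Theorems.PIDim4.PhiLine

end
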